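import Summits.KontsevichZagierPeriods.KontsevichZagierPeriods.Theorems.SymplecticScissorsRealOnePeriodRelationsLoopLayerCells

/-!
# Crux `RealOnePeriodRelations` (stmt-KontsevichZagierPeriods-10042), line `nash-retraction-thin-strip`, reshape 6
# (the LOG–LOOP layer): stub `stub_ratLoopCells` — CELLS of the joint layer

The log–loop layer joins the rational layer (generators: Kontsevich–Zagier's literal one-dimensional rational
representations, `KZ.IntegralRep.IsRational`) and the loop layer (polynomial cells, oval cells and branch cells of the
real Weierstrass curves `y² = x³ + A_j x + B_j`).  Its CELLS step is the sum of the two landed normalisations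
`RationalLayer.stub_ratCells` (unit rational cells) and `LoopLayer.stub_loopCells` (polynomial / odd-oval / branch
cells): the generating set `{r | rational ∨ loop}` is the union `{r | rational} ∪ {r | loop}`, so the generated subgroup
is `closure G₁ ⊔ closure G₂`, every element splits as `c = c₁ + c₂`, and the two `ℤ`-combinations add
(`Cells.combo_add`). [cite: KontsevichZagier2001, §1.2]
-/

noncomputable section

open scoped BigOperators Polynomial
open Set MeasureTheory MvPolynomial
open Literature.NumberTheory.Transcendental Literature.NumberTheory.Transcendental.CurvePeriods
open Summit.KontsevichZagierPeriods.SymplecticScissors.RealOnePeriodRelationsNegative (M₁ H₁ crux_iff unitDom)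

namespace Summit.KontsevichZagierPeriods.SymplecticScissors.RealOnePeriodRelations

namespace LogLoopLayer

/-- STUB `stub_ratLoopCells` — CELLS of the log–loop layer: every `c` in the subgroup generated by rational representations
(`KZ.IntegralRep.IsRational`), polynomial cells, oval cells and branch cells of the curves `y² = x³ + A_j x + B_j` is, modulo
`M₁`, a `ℤ`-combination of unit rational cells (`RationalLayer.stub_ratCells`) and of polynomial / odd-oval / branch cells
(`LoopLayer.stub_loopCells`): split `c` along `closure (G₁ ∪ G₂) = closure G₁ ⊔ closure G₂` and add the two normalisations.
[cite: KontsevichZagier2001, §1.2] -/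
theorem stub_ratLoopCells : ∀ (k : ℕ) (A B : Fin k → ℝ), (∀ j, IsAlgebraic ℚ (A j)) → (∀ j, IsAlgebraic ℚ (B j)) →
    ∀ c : KZ.FormalRep, c ∈ AddSubgroup.closure ((fun r : KZ.IntegralRep 1 => KZ.of r) ''
      {r | r.IsRational ∨
        (∃ a b : ℝ, IsAlgebraic ℚ a ∧ IsAlgebraic ℚ b ∧ a < b ∧ r.domain = {z | z 0 ∈ Set.Ioo a b} ∧
            ∃ P : Polynomial (algebraicClosure ℚ ℝ), ∀ x ∈ Set.Ioo a b, r.integrand (fun _ => x) = Polynomial.aeval x P) ∨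
        (∃ j, ∃ e₁ e₂ : ℝ, IsAlgebraic ℚ e₁ ∧ IsAlgebraic ℚ e₂ ∧ e₁ < e₂ ∧ e₁ ^ 3 + A j * e₁ + B j = 0 ∧
          e₂ ^ 3 + A j * e₂ + B j = 0 ∧ (∀ x ∈ Set.Ioo e₁ e₂, 0 < x ^ 3 + A j * x + B j) ∧
          r.domain = {z | z 0 ∈ Set.Ioo e₁ e₂} ∧
          ∃ P₁ P₂ P₃ : Polynomial (algebraicClosure ℚ ℝ), ∀ x ∈ Set.Ioo e₁ e₂,
            r.integrand (fun _ => x) = Polynomial.aeval x P₁ + Polynomial.aeval x P₂ * Real.sqrt (x ^ 3 + A j * x + B j) +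
              Polynomial.aeval x P₃ / Real.sqrt (x ^ 3 + A j * x + B j)) ∨
        (∃ j, ∃ e c₀ : ℝ, IsAlgebraic ℚ e ∧ IsAlgebraic ℚ c₀ ∧ e ^ 3 + A j * e + B j = 0 ∧
          (∀ x : ℝ, e < x → 0 < x ^ 3 + A j * x + B j) ∧ r.domain = {z | e < z 0} ∧
          ∀ z ∈ r.domain, r.integrand z = c₀ / Real.sqrt ((z 0) ^ 3 + A j * (z 0) + B j))}) →
    ∃ N : KZ.IntegralRep 1 →₀ ℤ, (∀ ρ ∈ N.support,
      (ρ.domain = {z | z 0 ∈ Set.Ioo (0 : ℝ) 1} ∧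
        ∃ P Q : Polynomial (algebraicClosure ℚ ℝ),
          (∀ t ∈ Set.Ioo (0 : ℝ) 1, Polynomial.aeval t Q ≠ 0) ∧
          ∀ t ∈ Set.Ioo (0 : ℝ) 1, ρ.integrand (fun _ => t) = Polynomial.aeval t P / Polynomial.aeval t Q) ∨
      (∃ a b : ℝ, IsAlgebraic ℚ a ∧ IsAlgebraic ℚ b ∧ a < b ∧ ρ.domain = {z | z 0 ∈ Set.Ioo a b} ∧
            ∃ P : Polynomial (algebraicClosure ℚ ℝ), ∀ x ∈ Set.Ioo a b, ρ.integrand (fun _ => x) = Polynomial.aeval x P) ∨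
        (∃ j, ∃ e₁ e₂ : ℝ, IsAlgebraic ℚ e₁ ∧ IsAlgebraic ℚ e₂ ∧ e₁ < e₂ ∧ e₁ ^ 3 + A j * e₁ + B j = 0 ∧
          e₂ ^ 3 + A j * e₂ + B j = 0 ∧ (∀ x ∈ Set.Ioo e₁ e₂, 0 < x ^ 3 + A j * x + B j) ∧
          ρ.domain = {z | z 0 ∈ Set.Ioo e₁ e₂} ∧
          ∃ P₂ P₃ : Polynomial (algebraicClosure ℚ ℝ), ∀ x ∈ Set.Ioo e₁ e₂,
            ρ.integrand (fun _ => x) = Polynomial.aeval x P₂ * Real.sqrt (x ^ 3 + A j * x + B j) +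
              Polynomial.aeval x P₃ / Real.sqrt (x ^ 3 + A j * x + B j)) ∨
        (∃ j, ∃ e c₀ : ℝ, IsAlgebraic ℚ e ∧ IsAlgebraic ℚ c₀ ∧ e ^ 3 + A j * e + B j = 0 ∧
          (∀ x : ℝ, e < x → 0 < x ^ 3 + A j * x + B j) ∧ ρ.domain = {z | e < z 0} ∧
          ∀ z ∈ ρ.domain, ρ.integrand z = c₀ / Real.sqrt ((z 0) ^ 3 + A j * (z 0) + B j))) ∧
      c - N.sum (fun ρ m => m • KZ.of ρ) ∈ M₁ := by
  classical
  intro k A B hA hB c hc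
  -- the generating set is a union, so the generated subgroup is a sup of two closures
  rw [Set.setOf_or, Set.image_union, AddSubgroup.closure_union] at hc
  obtain ⟨c₁, hc₁, c₂, hc₂, rfl⟩ := AddSubgroup.mem_sup.mp hc
  -- the two landed normalisations
  obtain ⟨N₁, hN₁, hcN₁⟩ := RationalLayer.stub_ratCells c₁ hc₁
  obtain ⟨N₂, hN₂, hcN₂⟩ := LoopLayer.stub_loopCells k A B hA hB c₂ hc₂
  refine ⟨N₁ + N₂, fun ρ hρ => ?_, ?_⟩
  · rcases Finset.mem_union.mp (Finsupp.support_add hρ) with h | h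
    · exact Or.inl (hN₁ ρ h)
    · exact Or.inr (hN₂ ρ h)
  · rw [Cells.combo_add]
    convert M₁.add_mem hcN₁ hcN₂ using 1
    abel

end LogLoopLayer

end Summit.KontsevichZagierPeriods.SymplecticScissors.RealOnePeriodRelations

end
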